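import Mathlib
import HarnessLib
import HarnessLib.Audit
import Summits.MatrixMultiplication.Statement
import Literature.Computability.AlgebraicComplexity.GroupTheoreticMatMul
import Literature.Computability.AlgebraicComplexity.GroupTheoreticMatMulProofs
import Literature.Computability.AlgebraicComplexity.FlatteningBound
import Literature.Computability.AlgebraicComplexity.SimultaneousDoubleProduct
import HarnessLib.Audit.Status.Attr

/-!
Route: EisensteinValCertificates

# Route EisensteinValCertificates — homocyclic prime-power STPP designs ⇒ ω = 2, decided at its one
live leaf (clustered two-families in ℤ/p); the Val certificate engine re-aimed at the two-families
threshold 4/3, because Pratt's Conjecture 4.1 itself is FALSE (Val(ℤ_n) ≥ n^(1+c), tree theorem)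

X′ = HOMOCYCLIC PRIME-POWER STPP DESIGNS (target HomocyclicSTPPDesigns): for every ε > 0 there are a
prime power q, an ℓ and an STPP family
(A_i,B_i,C_i)_(i<N) in (ℤ/q)^ℓ (tree `IsSTPP`, CKSU Def 5.1 additive) with Σ_i
(|A_i||B_i||C_i|)^((2+ε)/3) > q^ℓ. IT SUFFICES TO SHOW X′:
`closes : HomocyclicSTPPDesigns → MatrixMultiplication` is PROVED sorry-free in this file (CKSU Thm
5.5 abelian = tree theorem
`CohnKleinbergSzegedyUmans2005_5_5_abelian_holds`, ε := ω − 2, `omega_two_le`).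
REPAIR 2026-08-17 (rev 5). The original kill ladder PrimePowerPackingBarrier → PrimeValConjecture →
NoHomocyclicSTPP (= ¬X′) is DEAD and dropped:
Pratt's Conjecture 4.1 is false at every modulus (tree theorems
`AutomaticPackingThesis.prattVal_superlinear` / `prattVal_prime_not_subpolynomial`:
the CKSU 2005 §5 two-triple STPP design in ℤ/140, mass 144 > 140, powered losslessly along the
cyclic 140-tower and reflected into ℤ/N, N ≥ 3·140^k,
gives Val(ℤ/n) ≥ K n^(1+c); refuting theorem `EisensteinValCertificatesPrimeValConjecture_refuted`,
refuted-SUBSTANTIVE — a fixed-exponent cap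
Val(ℤ_p) ≤ K p^(1+c₀) is open but no longer feeds Pratt Thm 4.4, whose gain log(4/3)/log(3q) → 0 as
q → ∞); Pratt Cor 2.10 as typed
(PrimePowerPackingBarrier) is false too (`Literature.Combinatorics.Additive.not_Pratt2024_cor210`);
Thm 4.4 (ValTransfer) is vacuous
(`pratt2024_thm44_holds`). Lesson: no Val-type (mass) certificate obstructs designs in (ℤ/q)^ℓ with
q → ∞ — the Freiman transfer pays 3^ℓ, only a
mass gain survives it, and mass is superlinear in cyclic groups.
SHAPE NOW. (i) Deciding side: X′ is closed MODULO one open existence leaf, filed at this repair as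
crux ClusteredTwoFamilies — clustered SDPP
two-families in ℤ/p with merit m·d^(2/3)·(ab)^((2+ε)/3) > p for every ε; support LeafGivesDesigns :
leaf → X′ is the LANDED reduction (p155276), and
CKSU Conj 4.7 at primes = FourierTwoFamiliesModP.PrimeTwoFamilies ⟹ leaf is landed (p154020). (ii)
Kill side: NoHomocyclicSTPP (= ¬X′, support, no
mechanism of its own now) and FourierTwoFamiliesModP.PrimeCyclicPowerGain each refute the leaf (both
links LANDED, Theorems/…LeafSandwich.lean); the
card's Γ_p-symmetric SOS/Lasserre certificate engine — cruxes PrimeValSaving (3/2 − δ) and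
PrimeFourThirdsSaving (4/3 − δ), untouched by the
refutation — refutes PrimeTwoFamilies through the LANDED prime transfer
`primeTwoFamilies_false_of_primeFourThirdsSaving` (Pratt Thm 4.7 at
primes): it kills the two-families LIFT mechanism, the only positive mechanism known for X′, not X′
itself. OUTCOMES: leaf proved ⇒ X′ ⇒ ω(ℂ) = 2
through `closes`; leaf refuted (14309, 7787 or directly) ⇒ the lift line is dead and X′ keeps only
direct attempts (strategist R1's large-block
transfer, landed) — a new construction child or `exhausted`; PrimeFourThirdsSaving proved ⇒
¬PrimeTwoFamilies enters the negatives index (kills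
FourierTwoFamiliesModP's target and, via CyclicReduction, GroupTheoreticSTPP.CPackingConstruction)
but NOT the leaf, which is weaker than 14308.
It is NOT claimed that the Val cruxes bear on X′ any more.
Lean: `∀ ε : ℝ, 0 < ε → ∃ q ℓ : ℕ, IsPrimePow q ∧ ∃ (N : ℕ) (A B C : Fin N → Finset (Fin ℓ → ZMod
q)), Literature.Computability.AlgebraicComplexity.IsSTPP A B C ∧ (q : ℝ) ^ ℓ < ∑ i, (((A i).card *
(B i).card * (C i).card : ℕ) : ℝ) ^ ((2 + ε) / 3)`

## Assembly
Deciding theorem (D-0027 §2.1, unchanged by the repair): `theorem closes (h : HomocyclicSTPPDesigns)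
: MatrixMultiplication` — if ω := omega ℂ > 2
take ε := ω − 2 > 0; X′ yields a prime power q, an ℓ and an STPP family in H := (Fin ℓ → ZMod q)
with Σ_i (|A_i||B_i||C_i|)^(ω/3) > q^ℓ = |H|
(Fintype.card_fun, ZMod.card), contradicting CKSU Thm 5.5 abelian (tree theorem); hence ω ≤ 2, and
`omega_two_le ℂ` with `MatrixMultiplication_iff`
closes (native audit ok, hypotheses = [HomocyclicSTPPDesigns], axioms {propext, Classical.choice,
Quot.sound}). Below it every arrow quoted above is a
LANDED theorem (names under RANKED CRUXES; all re-checked in the repair planner's Sketch.lean, lean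
check rc 0, 0 sorries). The legacy item Assembly
(¬NoHomocyclicSTPP → MatrixMultiplication, candidate proof attached 2026-08-15) is kept as a
provable-now statement.

Rationale: WHY THIS LINE. Pratt (Pratt2024 = arXiv:2309.03878) reduced the live regime of the abelian
group-theoretic programme to one extremal quantity Val(G)
(Def 3.2: the maximum number of solutions of a+b+c = 0 over equilateral-trapezoid-free triples; |G|
≤ Val(G) ≤ |G|^(3/2), Prop 3.4; STPP ⇒ Val ≥ Σ n_i m_i p_i,
Prop 3.3; transfer Thm 4.4: ω = 2 from STPPs in Z_q^ℓ forces Val(Z_n) ≥ n^(1+c)) and conjectured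
Val(Z_n) ≤ n^(1+ε) (Conj 4.1, "our weakest conjecture").
THIS TREE SETTLED CONJ 4.1 IN THE NEGATIVE (2026-08-16/17):
`AutomaticPackingThesis.prattVal_superlinear` — the CKSU 2005 §5 two-triple STPP design in
ℤ/4 × ℤ/5 × ℤ/7 ≅ ℤ/140 has mass 144 > 140; read in base 140, its digit boxes form STPP families in
the CYCLIC tower ℤ/140^k of mass exactly 144^k (the
STPP kills every carry), so Val(ℤ/140^k) ≥ (140^k)^(1+c), c = log 144/log 140 − 1, and reflection
ℤ/M → ℤ/N (N ≥ 3M) gives Val(ℤ/n) ≥ (n/840)^(1+c) for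
all n; an independent witness (crux-strategist on stmt-10595, evidence on stmt-7789) re-hosts CKSU
local-strong-USP designs in cyclic ℤ/q^k with margin
digits, c ≈ 0.04–0.09. Hence the route's rank-3 crux PrimeValConjecture (Conj 4.1 at primes) is
refuted SUBSTANTIVELY
(`EisensteinValCertificatesPrimeValConjecture_refuted`), Pratt Cor 2.10 as typed
(PrimePowerPackingBarrier) is false (`not_Pratt2024_cor210`; the true
form bounds blockwise minima, `pratt2024_cor210_sumMin`, proved for primes), and Thm 4.4
(ValTransfer) is vacuous (`pratt2024_thm44_holds`): the whole
Val-transfer kill ladder is dropped at rev 5, and with it the claim that mass-type certificates can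
close the Z_q^ℓ (q → ∞) line — the generic Freiman
embedding Z_q^N ↪ ℤ/(3q)^N pays 3 per coordinate, so only an ω = 2-strength or MASS gain survives
it, and mass is superlinear in cyclic groups.
SHAPE now (rev 5): the deciding side was worked hard meanwhile (crux protocol on stmt-10647: two
registered lines, leads c1–c4, 20+ landed files
`Theorems/EisensteinValCertificatesHomocyclicSTPPDesigns*.lean`): X′ is closed MODULO one open
existence statement, the CLUSTERED TWO-FAMILIES LEAF, a
positive statement strictly between the deciding items of two routes — PrimeTwoFamilies
(FourierTwoFamiliesModP, CKSU Conj 4.7 at primes) ⟹ leaf ⟹ X′,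
PrimeCyclicPowerGain (their kill crux 14309) ⟹ ¬leaf, NoHomocyclicSTPP (our 7787) ⟹ ¬leaf, all four
LANDED (`clusteredTwoFamilies_sandwich`,
Theorems/…LeafSandwich.lean); the chart-capacity theorem (p159353/p159568) shows the leaf cannot be
reshaped sparser inside the line. This repair promotes
the leaf to the item ClusteredTwoFamilies (lead c3/c4 recommendation, strategist R2) with the glue
LeafGivesDesigns, so the route is again explicitly
TWO-SIDED with typed, landed links on both sides. The mechanism the card imported — convex /
real-algebraic DUALITY (Lasserre2001; symmetry reduction
GatermannParrilo2004, Schrijver2005; exact certificates à la Razborov2007) on the Γ_p = Z_p² ⋊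
(Z_p^× × S_3)-symmetric 0/1 program of trapezoid-free
triples, a Delsarte-style LP over frequency-order classes — keeps its two genuine targets, both
explicitly NOT affected by the refutation (both
refuters say so): the first power saving 3/2 − δ (PrimeValSaving; Pratt has only o(p^(3/2)), Prop
3.7, and Prop 4.8 shows one Cauchy–Schwarz is stuck at
3/2) and the two-families threshold 4/3 − δ (PrimeFourThirdsSaving), which now carries a LANDED kill
link `primeTwoFamilies_false_of_primeFourThirdsSaving :
PrimeFourThirdsSaving → ¬PrimeTwoFamilies` (Pratt Thm 4.7 at prime moduli,
Theorems/PrimeTwoFamilies/Negative/ValTransfer.lean): the certificates now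
obstruct the two-families LIFT mechanism — the only positive mechanism known for X′ — instead of X′.
What no other route does: GroupTheoreticSTPP's
CAbelianObstructionNeg asks a uniform ε over all abelian groups with no mechanism;
FourierTwoFamiliesModP attacks SDPP families by density increments;
this route holds the homocyclic STPP target with its proved `closes`, the typed leaf every
two-families lift must pass through, and the only
certificate technology aimed at Val's 4/3 threshold.

RANKED CRUXES. #0 HomocyclicSTPPDesigns (target/deciding crux; `closes : X′ → MatrixMultiplication`
proved) — X′ as in § Thesis. (why it might fail: open either way — needs q → ∞ (BCCGNSU Thm B,
tree), the Val obstruction is void (Conj 4.1 false), its only positive mechanism is the two-families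
lift through ClusteredTwoFamilies, refuted by PrimeCyclicPowerGain or NoHomocyclicSTPP if either
holds; TRUE iff STPPs in Z_p, Z_(p^k), (Z/q)^ℓ with q → ∞ reach ω = 2.)
[CohnKleinbergSzegedyUmans2005, BlasiakChurchCohnGrochowNaslundSawinUmans2017, Pratt2024,
lean:CohnKleinbergSzegedyUmans2005_5_5_abelian_holds,
lean:BlasiakChurchCohnGrochowNaslundSawinUmans2017_B_holds,
lean:AutomaticPackingThesis.prattVal_superlinear]
#2 PrimeValSaving (crux, the certificate engine's existence test) — ∃ δ > 0, K: every
equilateral-trapezoid-free (A,B,C) ⊂ ℤ/p (Pratt Def 3.2, the three one-solution systems inlined) has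
≤ K p^(3/2−δ) solutions of a+b+c = 0, p prime. Unaffected by the refutation (p^(1+c), c ≤ 0.09, is
far below 3/2 − δ). Expected proof shape: a bounded-degree Γ_p-symmetric SOS certificate using all
three systems. [difficulty: L] (why it might fail: no power saving is known in any cyclic group —
Pratt Prop 3.7 gives o(p^(3/2)) by removal, Prop 4.8 shows the one-system relaxation reaches
p^(3/2−o(1)) (Behrend), so bounded-degree SOS may be fooled by the same pseudo-solutions.)
[Pratt2024, Lasserre2001, GatermannParrilo2004, Schrijver2005, Razborov2007]
#3 ClusteredTwoFamilies (crux, NEW at rev 5 — the LEAF of the deciding side, verbatim the registered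
stub `stub_clusteredTwoFamilies` of crux 10647 with `A i − B i` spelled `Finset.image₂ (· − ·) (A i)
(B i)` since this file does not open Pointwise): ∀ ε > 0 ∃ prime p, an SDPP family (A_t,B_t)_(t<n)
in ℤ/p (tree `IsSDPP`: (W) each A_t ⊕ B_t direct, (X) a_i − a′_j + b_j − b′_k = 0 ⇒ i = k) with
|A_t| = a, |B_t| = b, ab ≥ 2, a class map cls : Fin n → Fin m with pairwise DISJOINT cross-class
difference sets A_t − B_t and classes of size ≥ d, and MERIT m·d^(2/3)·(ab)^((2+ε)/3) > p. Mechanism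
(landed, line clustered-charts): rotated SDPP charts × Behrend corner-free squares give local
chart-USPs whose CKSU-Thm-37 blocks form an STPP family in (ℤ/p)^(3k) beating 2+ε iff the merit
inequality holds. [difficulty: open-problem] (why it might fail: probably FALSE — merit forces both
packings tight up to (ab)^ε (σ₁σ₂ < (ab)^ε, landed stub_leafVersusPowerGain); every known cyclic
SDPP design has defect ratio c/γ ≥ 0.27, none witnesses any ε < 0.55; refuted by
PrimeCyclicPowerGain (14309) or NoHomocyclicSTPP (7787), links landed.)
[CohnKleinbergSzegedyUmans2005, Pratt2024,
lean:HomocyclicSTPPDesigns.ClusteredCharts.homocyclicSTPPDesigns_of_clusteredTwoFamilies,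
lean:HomocyclicSTPPDesigns.ClusteredCharts.not_clusteredTwoFamilies_of_primeCyclicPowerGain]
#4 PrimeFourThirdsSaving (crux, the 4/3 rung) — ∃ δ > 0, K with ≤ K p^(4/3−δ) solutions for every
prime p and every equilateral-trapezoid-free (A,B,C) ⊂ ℤ/p. Payoff LANDED: PrimeFourThirdsSaving →
¬FourierTwoFamiliesModP.PrimeTwoFamilies (`primeTwoFamilies_false_of_primeFourThirdsSaving`; CKSU §6
lift on a Behrend corner-free index set, mixed-radix Freiman map, Bertrand), hence ¬(CKSU Conj 4.7)
= ¬GroupTheoreticSTPP.CPackingConstruction by CyclicReduction (proved). [deps: PrimeValSaving]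
[difficulty: XL] (why it might fail: 4/3 is exactly the two-families threshold (Pratt Thm 4.7):
FALSE if CKSU Conj 4.7 at primes holds; Prop 4.8: one Cauchy–Schwarz cannot pass 3/2, so two of the
three trapezoid systems must interact in any certificate.) [Pratt2024,
CohnKleinbergSzegedyUmans2005, BlasiakChurchCohnGrochowNaslundSawinUmans2017,
lean:PrimeTwoFamilies.Negative.primeTwoFamilies_false_of_primeFourThirdsSaving]
#9 LeafGivesDesigns (support, NEW at rev 5, provable now in one line) — ClusteredTwoFamilies →
HomocyclicSTPPDesigns, by the landed reduction
`HomocyclicSTPPDesigns.ClusteredCharts.homocyclicSTPPDesigns_of_clusteredTwoFamilies` (p155276; the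
planner's Sketch.lean proves the item verbatim by `fun h => … h`). Makes the leaf load-bearing for
`closes`. [difficulty: provable-now]
#9 NoHomocyclicSTPP (support; the route's original target, the NEGATIVE MILESTONE = ¬X′) — ∃ ε > 0 ∀
prime powers q ∀ ℓ ∀ STPP families in (ℤ/q)^ℓ: Σ_i (|A_i||B_i||C_i|)^((2+ε)/3) ≤ q^ℓ. After the
refutation it has NO mechanism inside this route (the transfer from Conj 4.1 is void; Z_N has full
slice rank, BCCGU17 Thm B.8); it still refutes the leaf
(`not_clusteredTwoFamilies_of_noHomocyclicSTPP`, landed) and is implied by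
GroupTheoreticSTPP.CAbelianObstructionNeg. (why it might fail: false iff STPPs in Z_q^ℓ with q → ∞
reach ω = 2 — open; Thm B's ε_q → 0, and cyclic ℤ/q^k hosts USP designs as strong as (ℤ/m)^n does
(margin-digit re-hosting, evidence on 7789).) [Pratt2024,
BlasiakChurchCohnGrochowNaslundSawinUmans2017, BlasiakChurchCohnGrochowUmans2017,
CohnKleinbergSzegedyUmans2005, lean:BlasiakChurchCohnGrochowNaslundSawinUmans2017_B_holds]
#9 NoHomocyclicIffNotDesigns (support) — NoHomocyclicSTPP ↔ ¬HomocyclicSTPPDesigns; PROVED by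
refuter g44-27 (evidence Proof_EVC_NoHomocyclicIffNotDesigns.lean, rc 0) — a prover lands it
verbatim. [difficulty: provable-now]
#9 TrapezoidCountBound (support, calibration) — (#solutions)² ≤ |A||B||C| for trapezoid-free triples
in any abelian group = tree theorem `IsEquilateralTrapezoidFree.card_zeroSumTriples_sq_le`
(candidate proof attached); the degree-4 certificate PrimeValSaving must beat by p^δ. [difficulty:
provable-now]
#9 STPPGivesVal (support) — Pratt Prop 3.3: an STPP family yields a trapezoid-free triple with ≥
Σ|A_i||B_i||C_i| solutions; candidate proof attached by grounder g15-32 (tree composite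
isSTPP_iff_addSimultaneousTPP + isEquilateralTrapezoidFree_of_addSimultaneousTPP +
sum_card_mul_le_card_zeroSumTriples). The bridge used by every Val transfer, incl. the landed 4/3
kill. [difficulty: provable-now]
#1 Assembly (legacy assembly item) — ¬NoHomocyclicSTPP → MatrixMultiplication; candidate proof
attached (route review 2026-08-15). [difficulty: provable-now]
SETTLED / DROPPED AT REV 5 (kept in the file as comment records; PrimeValConjecture stays in `ledger
negatives`): PrimeValConjecture (stmt-7789, ex-#3, REFUTED-substantive by
`EisensteinValCertificatesPrimeValConjecture_refuted` @ 0efa074c7b39 from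
`prattVal_prime_not_subpolynomial`; never a hypothesis of `closes`); PrimePowerPackingBarrier
(stmt-7793, FALSE as typed: its text is verbatim Literature's `Pratt2024_cor210`, refuted by
`not_Pratt2024_cor210`, besides the empty-part junk flagged by grounder g15-32; true form =
`pratt2024_cor210_sumMin`; no consumer left); ValTransfer (stmt-7794, vacuous: hypothesis refuted,
and `pratt2024_thm44_holds` proved with an unconditional conclusion; it never rendered — blocked on
missing decls). PROVER NOTE (migrate the refutation module): from rev 5 the constant
`…Theses.EisensteinValCertificates.PrimeValConjecture` is no longer rendered in this file, so
`Theorems/EisensteinValCertificatesPrimeValConjectureRefutation.lean` must re-declare `def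
PrimeValConjecture : Prop := <ledger signature of stmt-7789, verbatim>` in namespace
`Summit.MatrixMultiplication.MatrixMultiplication.Theses.EisensteinValCertificates` ahead of the
theorem (pattern of Theorems/DesignFlatteningSeparableDesignsMultiplicativeRefutation.lean); the
fixed module is attached as evidence
`EisensteinValCertificatesPrimeValConjectureRefutation.fixed.lean` on stmt-MatrixMultiplication-7789
— land it as is (theorem text unchanged). The crux workfile
Cruxes/ThinPackings/StrategyCensusSketchP1.lean names the constant too (scratch, not in the build).

TWO-LAYER PLAN. The deciding side's one more layer is now filed (leaf + glue); no `--split` of X′ is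
recorded because a second child would not be a conjunct (strategist R1's LargeBlockAbelianDesigns —
"some STPP family in an abelian group of large exponent beats 2+ε", transfer to (ℤ/q)^ℓ LANDED
p150288/p151034, PrimeTwoFamilies → it LANDED p150594 — is an ALTERNATIVE sufficient condition, i.e.
a second line on X′, to be filed as an item only if a lead picks it). Foreseen below the Val cruxes
(nothing filed): PrimeValSaving ⇐ UniformDualPattern (a level-d dual multiplier depending only on
the order of the frequency and the multiplier orbit, valid for all primes) → RoundingStep (exact
rational certificate) → PrimeValSaving; PrimeFourThirdsSaving's transfer item is NOT needed any more
(landed as a theorem). If FourierTwoFamiliesModP's planner agrees, ClusteredTwoFamilies should also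
be wanted there (it generalises their 14308 and is refuted by their 14309) — recommendation
recorded, not acted on from this seat.

KILL CRITERIA. (a) ClusteredTwoFamilies REFUTED — by
`not_clusteredTwoFamilies_of_primeCyclicPowerGain` once 14309 is proved, by
`not_clusteredTwoFamilies_of_noHomocyclicSTPP` once 7787 is, or directly ⇒ the two-families lift
line is dead; X′ then has no live positive mechanism: the tenure planner files the large-block line
as a child if a lead wants it, else closes `exhausted` with the census (X′ itself is a ∀ε∃ statement
with no finite falsifier; BCCGNSU Thm B forces q → ∞ in any witness). (b) X′ REFUTED outright (a
proof of NoHomocyclicSTPP from outside, e.g. GroupTheoreticSTPP.CAbelianObstructionNeg) ⇒ close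
`refuted:HomocyclicSTPPDesigns`, the designed negative end (negatives index: "no STPP route to ω = 2
through (ℤ/q)^ℓ"). (c) ClusteredTwoFamilies or X′ PROVED ⇒ ω(ℂ) = 2 through `closes`. (d)
PrimeFourThirdsSaving proved ⇒ ¬PrimeTwoFamilies lands (kills FourierTwoFamiliesModP's target and
CPackingConstruction) — informative but decides nothing here (leaf weaker than 14308);
PrimeValSaving refuted (Val(ℤ_p) ≥ p^(3/2−o(1))) ⇒ drop both Val cruxes, the engine is blind;
PrimeFourThirdsSaving refuted alone (e.g. by a two-families construction, which would also prove the
leaf) ⇒ drop it. The refutation of PrimeValConjecture (2026-08-17) was case "pivot, not close" of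
the rev-4 criteria: executed at rev 5 — EXCEPT that ranks 2 and 4 are kept, against the rev-4 text
"drop ranks 2–4", because both refuters certify them unaffected and rank 4 has since acquired a
landed kill link to the live line's parent statement.

NOT DECOMPOSED YET. The certificate level d and which (frequency-order, multiplier-orbit) blocks
carry the dual weight — decided by the first computation; the rounding step from numerical duals to
exact rational certificates; an all-abelian uniform saving sup_G log Val(G)/log|G| < 3/2 (plausible
from Prop 3.7 + supermultiplicativity, not needed); a direct kill statement for X′ with a mechanism
— NONE is known after Conj 4.1's death (a uniform power saving N·s^(2+c) ≤ q^ℓ for balanced STPP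
families in (ℤ/q)^ℓ would do, but it is ¬X′ reworded; the STPP analogue of FourierTwoFamiliesModP's
density-increment programme is unwritten), so none is filed; the large-block line (Two-layer plan);
wanting ClusteredTwoFamilies from FourierTwoFamiliesModP (their planner's call).

CHEAPEST FALSIFIER. (i) For ClusteredTwoFamilies: the packing bookkeeping is landed
(`stub_leafPacking`: n·a ≤ p, n·b ≤ p, m·ab ≤ p, m·d ≤ n, (n−1)a + m·ab ≤ p) and gives merit ⟺
(ab)^ε > σ₁σ₂ with σ₁ = p²/(n²ab), σ₂ = p/(m·ab): a refuter checks any claimed witness family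
against these in one line, and every catalogued cyclic SDPP design (translates, digit images, CRT
cubes; Cruxes/PrimeTwoFamilies/STRATEGY-CENSUS.md scale calculus, defect ratio ≥ 0.2729) fails for ε
< 0.55; finite censuses are uninformative (at p ≤ 31, ab = 4 every family has merit exponent ≈ 2;
LEAF-ANALYSIS.md), so no compute job is attached. (ii) For the Val cruxes, unchanged: level-2/3
Lasserre values v_d(p) of the Val(ℤ_p) program for primes p ≤ 60 with the Γ_p block-diagonalisation
— if log v_3(p)/log p tracks 3/2 with structureless duals, bounded-degree SOS is blind and cruxes 2,
4 lose their engine; if v_d(p) ≤ C p^(3/2−δ) numerically, the dual pattern IS the proof sketch of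
PrimeValSaving. Exact small values (rev-1 exhaustive run): Val(ℤ_n) = n for 2 ≤ n ≤ 10; the
superlinear regime starts only along 140^k / margin-digit towers (n ≥ 140), consistent. (iii) X′: no
finite falsifier; Thm B dismisses any claimed family with q bounded.

NUMBERS. |G| ≤ Val(G) ≤ |G|^(3/2), Val(G) = o(|G|^(3/2)) (Pratt Prop 3.4, 3.7); NOW ALSO Val(ℤ/n) ≥
(n/840)^(1+c), c = log m/log 140 − 1 with m ≥ 141 (tree, prattVal_superlinear; second witness c ≈
0.039–0.09 from margin-digit USP towers) — Conj 4.1 false; thresholds: exponent 4/3 ⇔ CKSU two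
families (Thm 4.7; prime transfer landed), 3/2 = trivial (TrapezoidCountBound); (ℤ/m)^n with m fixed
carries the CW/CKSU record STPPs (Val ≥ |G|^(1+c), BCCGNSU17 §1 p.3) and is capped strictly above 2
for each fixed m (Thm B, ε_q → 0); leaf numerics: merit needs (ab)^ε > σ₁σ₂ ≥ 1, ab > (27/16)^(1/ε),
b^(1−ε) < a^(1+ε); known cyclic SDPP designs: defect ratio c/γ ≥ 0.2729 ⇒ no witness below ε ≈ 0.55;
chart capacity L³(ab)^k ≤ 27^k n^(2k) p^k (p159353). Items after rev 5: 11 (target/deciding crux X′,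
cruxes PrimeValSaving, ClusteredTwoFamilies, PrimeFourThirdsSaving; supports LeafGivesDesigns,
NoHomocyclicSTPP, NoHomocyclicIffNotDesigns, TrapezoidCountBound, STPPGivesVal; legacy Assembly) +
`closes`; dropped 3 (PrimeValConjecture refuted, PrimePowerPackingBarrier false, ValTransfer
vacuous).

DEFINITION REQUESTS. None open: `IsEquilateralTrapezoidFree`, `prattVal` (Pratt Def 3.2) and
`IsSDPP` (CKSU Def 4.1) exist in Literature (PrattTrapezoidVal.lean, SimultaneousDoubleProduct.lean
— the latter imported from rev 5 for ClusteredTwoFamilies); the cite facts once wanted for the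
dropped ladder (FoxLovasz2017 Thm 1 / Pratt Cor 2.10, Thm 4.4, Thm 4.7) are all discharged in tree
(FoxLovasz2017_thm1_holds, pratt2024_cor210_sumMin, pratt2024_thm44_holds, pratt2024_thm47_holds).

Novelty: Searches (2026-08-15): `lit search "generalized corners matrix multiplication trapezoid-free skew
corner-free"` (local 1: paper:arxiv-2309.03878;
crossref 15, relevant doi:10.19086/da.144040 and doi:10.1017/s0305004125000076; openalex/s2/arxiv
HTTP 429 all session);
`lit citing arxiv:2309.03878` (5: arXiv:2503.08258, 2404.07380, 2401.17507, 2402.19169, 2404.07180 —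
skew corners and model theory, none
on Val or certificates); `lit frontier MatrixMultiplication --since 2023` (30 rows: asymptotic
spectrum / tensor methods, nothing
additive-combinatorial); `lit galaxy search "trapezoid-free" --star all` (0); `lit galaxy search
"skew corner-free" --star all` (0);
`lit galaxy search "simultaneous triple product property" --star all` (5: CKSU05 pdf, Sawin
arXiv:1702.00905, Stothers thesis ×2,
Landsberg GCT book); `lit search --source zbmath "semidefinite programming bounds additive
combinatorics sum-free sets cyclic group"` (0);
`lit search --source crossref "flag algebras additive combinatorics abelian groups"` (12, noise);
`lit search --hybrid "tight bound Green
arithmetic triangle removal lemma vector spaces Fox Lovász"` (10 books, none holds it; cited by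
DOI); full read of arXiv:2309.03878 pp. 1–13
(no LP/SDP/SOS anywhere; the §4.1 relaxations are combinatorial); the 24 Theses files of the
sub-problem (only GroupTheoreticSTPP mentions
Pratt or Val, in why-might-fail text; no route has a Val item); `ledger negatives --problem
MatrixMultiplication` (0).
Nearest prior art found: Pr  [refs: 10.19086/da.144040, 10.1017/s0305004125000076, 2309.03878, 2503.08258, 1702.00905, paper:arxiv-2309.03878, doi:10.19086/da.144040, doi:10.1017/s0305004125000076, arxiv:2309.03878, Pratt2024, GatermannParrilo2004, Schrijver2005, Razborov2007, Lasserre2001, BlasiakChurchCohnGrochowNaslundSawinUmans2017]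

Barriers (technique_class: group-theoretic-approach, additive-obstruction, SOS): - technique_class: group-theoretic-approach, additive-obstruction, SOS
- Literature.Barriers.MatrixMultiplication.TricoloredSumFreeBarrier: an ally, not an obstacle — the
route works on the COMPLEMENT of its scope (q → ∞: Z_p, Z_(p^k); its evasions_known (a)), where
slice rank is provably powerless (ℤ/N has full slice rank, BCCGU17 Thm B.8), which is why a
different certificate class (SOS over subsets with arithmetic weights) is proposed; its Thm A′
(proved in tree) is consumed by PrimePowerPackingBarrier, and X would extend its Thm B to a uniform
ε over all q.
- Literature.Barriers.MatrixMultiplication.EquivoluminousBarrier: same side (an obstruction to a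
CW-type combinatorial hypothesis by sunflower/slice-rank bounds); it does not bite —
PrimeValConjecture is the analogous kill-statement for cyclic groups and needs a
non-polynomial-method proof, the route's raison d'être.
- Literature.Barriers.MatrixMultiplication.NilpotentGroupBarrier: not in class (non-abelian p-group
/ nilpotent hosts); the route is abelian and obstruction-side.
- Literature.Barriers.MatrixMultiplication.QuasirandomBarrier: not in class (quasirandom non-abelian
hosts).
- Literature.Barriers.MatrixMultiplication.NormalizerBarrier: not in class (subgroup TPP triples in
non-abelian groups; Val obstructs arbitrary subsets of Z_q^ℓ).
- Literature.Barriers.MatrixMultiplication.YoungSubgroupBarrier: not in class (Young subgroups of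
S_n).
- Literature.Barriers.MatrixMultiplication.IrreversibilityBarrier: not in

Novelty grade: new-combination — route-review+novelty (refuter 2026-08-15). new-combination, as filed: every Lean ITEM is a printed Pratt2024 object (7789=Conj 4.1 at primes, 7793=Cor 2.10 explicit-K, 7794=Thm 4.4, 7792=Prop 3.3, 7791=Prop 3.1 already a tree thm) or its uniform-ε contrapositive (X=7787, prime-power half of GroupThe (refuter refuter-rreview-route-MatrixMultiplicati-fbd7c3e5-0, 2026-08-15T13:39:57Z; prior: Pratt2024 arXiv:2309.03878,BlasiakChurchCohnGrochowNaslundSawinUmans2017 arXiv:1605.06702,BlasiakChurchCohnGrochowUmans2017,FoxLovasz2017,Lasserre2001,GatermannParrilo2004,Schrijver2005,Razborov2007,Beker2025 arXiv:2401.17507,arXiv:2404.07380)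

History (route lifecycle, newest last):
- 2026-08-16T02:18:12Z · AUTO-CRUX: 1 conjecture-grade item(s) promoted to crux (ValTransfer) — refuter vetting / tiering apply (operator:999:1362873)
- 2026-08-16T04:10:43Z · AUTO-CRUX (backfill): HomocyclicSTPPDesigns — hypotheses of the deciding theorem that nothing in the route derives are cruxes (operator:999:1085951)
- 2026-08-17T12:36:46Z · BROKEN — PrimeValConjecture (stmt-MatrixMultiplication-7789, crux) refuted by Summit.MatrixMultiplication.MatrixMultiplication.Theorems.EisensteinValCertificatesPrimeValConjecture_refuted @ 0efa074c7b39 (refuter-eread-MatrixMultiplication-Eisenst-625de679-1-0)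
- 2026-08-17T13:07:07Z · rev 5: dropped PrimeValConjecture, ValTransfer, PrimePowerPackingBarrier — repair (route-repair seat, rev 5): PrimeValConjecture (stmt-7789) refuted-SUBSTANTIVE by EisensteinValCertificatesPrimeValConjecture_refuted (Pratt Conj 4.1 fal (planner-rrefute-MatrixMultiplication-Eisenstei-4e78eba0-0)
- 2026-08-17T13:07:08Z · REPAIRED (drop PrimeValConjecture, ValTransfer, PrimePowerPackingBarrier; add ClusteredTwoFamilies, LeafGivesDesigns) — back to open: repair (route-repair seat, rev 5): PrimeValConjecture (stmt-7789) refuted-SUBSTANTIVE by EisensteinValCertificatesPrimeValConjecture_refuted (Pratt Conj 4.1 fal (planner-rrefute-MatrixMultiplication-Eisenstei-4e78eba0-0)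

sub-problem: MatrixMultiplication · status: open · opened planner-plancard-MatrixMultiplication-MatrixM-f314d2e8-0 2026-08-15T12:18:39Z · rev 6 · ledger route-MatrixMultiplication-EisensteinValCertificates
GENERATED by the gate from the ledger (D-0016/17). Provers cite these decls: `theorem foo : Summit.MatrixMultiplication.MatrixMultiplication.Theses.EisensteinValCertificates.<Decl> := …` in Summits/MatrixMultiplication/MatrixMultiplication/Theorems/<Name>.lean.
-/

namespace Summit.MatrixMultiplication.MatrixMultiplication.Theses.EisensteinValCertificates

open scoped BigOperators Topology Manifold Classical MeasureTheory ProbabilityTheory Matrix InnerProductSpace ComplexConjugate ContinuousMap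
open Filter Set Function TopologicalSpace MeasureTheory

attribute [summit_statement] _root_.MatrixMultiplication

/-- item stmt-MatrixMultiplication-10647 · crux (kind.auto-crux: conjecture-grade) · rank 0 · open · by planner
why it might fail: Open either way: needs q → ∞ (BCCGNSU Thm B); the Val obstruction is VOID (Conj 4.1 false, prattVal_superlinear); only positive mechanism = two-families lift via ClusteredTwoFamilies, refuted by PrimeCyclicPowerGain (14309) or NoHomocyclicSTPP (7787) if either holds; TRUE iff q → ∞ STPPs give ω = 2.
sources: CohnKleinbergSzegedyUmans2005, BlasiakChurchCohnGrochowNaslundSawinUmans2017, Pratt2024, lean:Literature.Computability.AlgebraicComplexity.CohnKleinbergSzegedyUmans2005_5_5_abelian_holds, lean:Literature.Computability.AlgebraicComplexity.BlasiakChurchCohnGrochowNaslundSawinUmans2017_B_holds, lean:Summit.MatrixMultiplication.MatrixMultiplication.Theorems.AutomaticPackingThesis.prattVal_superlinear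
[target] X′ (D-0027 route-repair 2026-08-15: the DECIDING side of the dichotomy becomes the target):
for every ε > 0 there are a prime power q, an ℓ and an STPP family (A_i,B_i,C_i)_(i<N) in (ℤ/q)^ℓ
(tree `IsSTPP`) with Σ_i (|A_i||B_i||C_i|)^((2+ε)/3) > q^ℓ — homocyclic prime-power STPP designs
beating every exponent 2+ε; the positive form of ¬NoHomocyclicSTPP (support
NoHomocyclicIffNotDesigns). Decides the summit: `closes : HomocyclicSTPPDesigns →
MatrixMultiplication` (CKSU Thm 5.5 abelian, tree theorem, with ε = ω − 2 and omega_two_le;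
sorry-free). The route's ranked cruxes are the KILL LADDER of this target (they compose, via
ValTransfer and PrimePowerPackingBarrier, to NoHomocyclicSTPP = ¬X′). [difficulty: open-problem] -/
@[route_item "route-MatrixMultiplication-EisensteinValCertificates", crux]
def HomocyclicSTPPDesigns : Prop :=
  ∀ ε : ℝ, 0 < ε → ∃ q ℓ : ℕ, IsPrimePow q ∧ ∃ (N : ℕ) (A B C : Fin N → Finset (Fin ℓ → ZMod q)), Literature.Computability.AlgebraicComplexity.IsSTPP A B C ∧ (q : ℝ) ^ ℓ < ∑ i, (((A i).card * (B i).card * (C i).card : ℕ) : ℝ) ^ ((2 + ε) / 3)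

/-- item stmt-MatrixMultiplication-7788 · crux · rank 2 · open · by planner
why it might fail: No power saving is known in any cyclic group: Pratt Prop 3.7 gives o(p^{3/2}) (removal), Prop 4.8 shows the one-system relaxation reaches p^{3/2−o(1)} (Behrend), so bounded-degree SOS may be fooled by the same pseudo-solutions. (Unaffected by Conj 4.1's refutation: p^{1+c}, c ≤ 0.09 ≪ 3/2−δ.)
sources: Pratt2024, Lasserre2001, GatermannParrilo2004, Schrijver2005, Razborov2007
[crux] first power saving for Pratt's Val at prime moduli (card item T2, the certificate engine's
existence test): ∃ δ > 0 and K such that for every prime p and every equilateral-trapezoid-free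
triple (A,B,C) of subsets of ℤ/p (Pratt Def 3.2, additive: for fixed a' ∈ A, b' ∈ B the system
a'+b+c = 0 = a+b'+c has at most one solution (a,b,c) ∈ A×B×C, and likewise for fixed (a',c') and
fixed (b',c')), the number of (a,b,c) ∈ A×B×C with a+b+c = 0 is ≤ K p^(3/2−δ). Expected proof shape:
a Γ_p-symmetric SOS certificate of bounded degree that uses all three systems. [difficulty: L] -/
@[route_item "route-MatrixMultiplication-EisensteinValCertificates"]
def PrimeValSaving : Prop :=
  ∃ δ : ℝ, 0 < δ ∧ ∃ K : ℝ, ∀ p : ℕ, p.Prime → ∀ A B C : Finset (ZMod p), ((∀ a' ∈ A, ∀ b' ∈ B, ((A ×ˢ B ×ˢ C).filter (fun t : ZMod p × ZMod p × ZMod p => a' + t.2.1 + t.2.2 = 0 ∧ t.1 + b' + t.2.2 = 0)).card ≤ 1) ∧ (∀ a' ∈ A, ∀ c' ∈ C, ((A ×ˢ B ×ˢ C).filter (fun t : ZMod p × ZMod p × ZMod p => a' + t.2.1 + t.2.2 = 0 ∧ t.1 + t.2.1 + c' = 0)).card ≤ 1) ∧ (∀ b' ∈ B, ∀ c' ∈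 C, ((A ×ˢ B ×ˢ C).filter (fun t : ZMod p × ZMod p × ZMod p => t.1 + b' + t.2.2 = 0 ∧ t.1 + t.2.1 + c' = 0)).card ≤ 1)) → ((((A ×ˢ B ×ˢ C).filter (fun t : ZMod p × ZMod p × ZMod p => t.1 + t.2.1 + t.2.2 = 0)).card : ℕ) : ℝ) ≤ K * (p : ℝ) ^ ((3 : ℝ) / 2 - δ)

/-- item stmt-MatrixMultiplication-18134 · crux · rank 3 · open · by planner
why it might fail: Probably FALSE: merit forces both packings tight up to (ab)^ε (σ₁σ₂ < (ab)^ε, landed stub_leafVersusPowerGain); every known cyclic SDPP design has defect ratio c/γ ≥ 0.27, none witnesses any ε < 0.55; refuted by PrimeCyclicPowerGain (14309) or NoHomocyclicSTPP (7787), links landed.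
sources: CohnKleinbergSzegedyUmans2005, Pratt2024, BlasiakChurchCohnGrochowNaslundSawinUmans2017, lean:Summit.MatrixMultiplication.MatrixMultiplication.Theorems.HomocyclicSTPPDesigns.ClusteredCharts.homocyclicSTPPDesigns_of_clusteredTwoFamilies, lean:Summit.MatrixMultiplication.MatrixMultiplication.Theorems.HomocyclicSTPPDesigns.ClusteredCharts.not_clusteredTwoFamilies_of_primeCyclicPowerGain
[crux] the clustered two-families LEAF of the deciding side (registered stub
`stub_clusteredTwoFamilies` of crux stmt-MatrixMultiplication-10647, promoted at the rev-5 repair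
per lead c3/c4 + strategist R2): for every ε > 0 a prime p, an SDPP family (A_t,B_t)_(t<n) in ℤ/p
(tree `IsSDPP` = CKSU Def 4.1: (W) each A_t ⊕ B_t direct, (X) a_i − a′_j + b_j − b′_k = 0 ⇒ i = k)
with |A_t| = a, |B_t| = b, ab ≥ 2, a class map cls : Fin n → Fin m with pairwise DISJOINT
cross-class difference sets A_t − B_t (spelled `Finset.image₂ (· - ·) (A t) (B t)`, = `Finset.sub`
unfolded: this file does not open Pointwise; defeq to the stub's `A t - B t`, checked in the
planner's Sketch.lean) and classes of size ≥ d, and MERIT m·d^(2/3)·(ab)^((2+ε)/3) > p. Sandwich,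
all LANDED (Theorems/EisensteinValCertificatesHomocyclicSTPPDesignsLeafSandwich.lean,
`clusteredTwoFamilies_sandwich`): FourierTwoFamiliesModP.PrimeTwoFamilies (stmt-14308) ⟹ leaf
(`stub_clusteredOfPrimeTwoFamilies`, p154020); leaf ⟹ HomocyclicSTPPDesigns
(`homocyclicSTPPDesigns_of_clusteredTwoFamilies`, p155276 = item LeafGivesDesigns);
FourierTwoFamiliesModP.PrimeCyclicPowerGain (stmt-14309) ⟹ ¬leaf
(`not_clusteredTwoFamilies_of_primeCyclicPo -/
@[route_item "route-MatrixMultiplication-EisensteinValCertificates", crux]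
def ClusteredTwoFamilies : Prop :=
  ∀ ε : ℝ, 0 < ε → ∃ p : ℕ, p.Prime ∧ ∃ (n m a b d : ℕ) (A B : Fin n → Finset (ZMod p)) (cls : Fin n → Fin m), Literature.Computability.AlgebraicComplexity.IsSDPP A B ∧ 2 ≤ a * b ∧ (∀ i, (A i).card = a ∧ (B i).card = b) ∧ (∀ i j, cls i ≠ cls j → Disjoint (Finset.image₂ (· - ·) (A i) (B i)) (Finset.image₂ (· - ·) (A j) (B j))) ∧ (∀ c : Fin m, d ≤ (Finset.univ.filter fun i => cls i = c).card) ∧ (p : ℝ) < (m : ℝ) * (d : ℝ) ^ ((2 : ℝ) / 3) * ((a * b : ℕ) : ℝ) ^ ((2 + ε) / 3)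

/-- item stmt-MatrixMultiplication-7790 · crux · rank 4 · open · by planner
why it might fail: 4/3 is exactly the two-families threshold (Pratt Thm 4.7): FALSE if CKSU Conj 4.7 at primes (FourierTwoFamiliesModP.PrimeTwoFamilies, 14308) holds — kill link PrimeFourThirdsSaving → ¬PrimeTwoFamilies LANDED; Prop 4.8: one Cauchy–Schwarz cannot pass 3/2, two trapezoid systems must interact.
sources: Pratt2024, CohnKleinbergSzegedyUmans2005, BlasiakChurchCohnGrochowNaslundSawinUmans2017, lean:Summit.MatrixMultiplication.MatrixMultiplication.Theorems.PrimeTwoFamilies.Negative.primeTwoFamilies_false_of_primeFourThirdsSaving, lean:Literature.Computability.AlgebraicComplexity.pratt2024_thm47_holds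
[crux] the 4/3 rung: ∃ δ > 0 and K with #(a+b+c = 0 in A×B×C) ≤ K p^(4/3−δ) for every prime p and
every equilateral-trapezoid-free (A,B,C) ⊂ ℤ/p. Payoff (Pratt Thm 4.7; the transfer item is filed
when this closes): refutes CKSU's two-families Conjecture 4.7, i.e.
¬GroupTheoreticSTPP.CPackingConstruction. [deps: PrimeValSaving] [difficulty: XL] -/
@[route_item "route-MatrixMultiplication-EisensteinValCertificates"]
def PrimeFourThirdsSaving : Prop :=
  ∃ δ : ℝ, 0 < δ ∧ ∃ K : ℝ, ∀ p : ℕ, p.Prime → ∀ A B C : Finset (ZMod p), ((∀ a' ∈ A, ∀ b' ∈ B, ((A ×ˢ B ×ˢ C).filter (fun t : ZMod p × ZMod p × ZMod p => a' + t.2.1 + t.2.2 = 0 ∧ t.1 + b' + t.2.2 = 0)).card ≤ 1) ∧ (∀ a' ∈ A, ∀ c' ∈ C, ((A ×ˢ B ×ˢ C).filter (fun t : ZMod p × ZMod p × ZMod p => a' + t.2.1 + t.2.2 = 0 ∧ t.1 + t.2.1 + c' = 0)).card ≤ 1) ∧ (∀ b' ∈ B, ∀ c' ∈ C, ((A ×ˢ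 B ×ˢ C).filter (fun t : ZMod p × ZMod p × ZMod p => t.1 + b' + t.2.2 = 0 ∧ t.1 + t.2.1 + c' = 0)).card ≤ 1)) → ((((A ×ˢ B ×ˢ C).filter (fun t : ZMod p × ZMod p × ZMod p => t.1 + t.2.1 + t.2.2 = 0)).card : ℕ) : ℝ) ≤ K * (p : ℝ) ^ ((4 : ℝ) / 3 - δ)

/-- item stmt-MatrixMultiplication-7787 · support · rank 0 · open · by planner
why it might fail: False iff STPPs in Z_q^ℓ with q → ∞ reach ω = 2 (open). NO mechanism left in this route: the transfer from Conj 4.1 is void (Conj 4.1 false: prattVal_superlinear; Cor 2.10 as typed false: not_Pratt2024_cor210); Z_N has full slice rank (BCCGU17 Thm B.8). Still refutes the leaf (landed).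
sources: Pratt2024, BlasiakChurchCohnGrochowNaslundSawinUmans2017, BlasiakChurchCohnGrochowUmans2017, CohnKleinbergSzegedyUmans2005, lean:Literature.Computability.AlgebraicComplexity.BlasiakChurchCohnGrochowNaslundSawinUmans2017_B_holds, lean:Summit.MatrixMultiplication.MatrixMultiplication.Theorems.HomocyclicSTPPDesigns.ClusteredCharts.not_clusteredTwoFamilies_of_noHomocyclicSTPP
[target] X as in § Thesis — ∃ ε > 0 such that for every prime power q, every ℓ and every STPP family
(A_i,B_i,C_i)_(i<N) in (ℤ/q)^ℓ, Σ_i (|A_i||B_i||C_i|)^((2+ε)/3) ≤ q^ℓ (the contrapositive output of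
Pratt Thm 4.4; covers bounded exponent (Thm B) and Z_p, Z_(p^k) with p^k → ∞ at once). -/
@[route_item "route-MatrixMultiplication-EisensteinValCertificates"]
def NoHomocyclicSTPP : Prop :=
  ∃ ε : ℝ, 0 < ε ∧ ∀ q ℓ : ℕ, IsPrimePow q → ∀ (N : ℕ) (A B C : Fin N → Finset (Fin ℓ → ZMod q)), Literature.Computability.AlgebraicComplexity.IsSTPP A B C → ∑ i, (((A i).card * (B i).card * (C i).card : ℕ) : ℝ) ^ ((2 + ε) / 3) ≤ (q : ℝ) ^ ℓ

/-- item stmt-MatrixMultiplication-10648 · support · rank 9 · open · by planner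
sources: CohnKleinbergSzegedyUmans2005, Pratt2024
[support] bookkeeping, provable now (pure logic: `push Not`; proved in the repair planner's
Sketch.lean, 3 lines): the negative milestone NoHomocyclicSTPP is exactly the negation of the target
— a proof of NoHomocyclicSTPP (= ValTransfer ∘ PrimePowerPackingBarrier ∘ PrimeValConjecture) is a
one-line refutation of HomocyclicSTPPDesigns and closes the route refuted:HomocyclicSTPPDesigns with
the prime-power STPP line recorded as negative knowledge. [difficulty: provable-now] -/
@[route_item "route-MatrixMultiplication-EisensteinValCertificates"]
def NoHomocyclicIffNotDesigns : Prop :=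
  NoHomocyclicSTPP ↔ ¬ HomocyclicSTPPDesigns

/-- item stmt-MatrixMultiplication-18135 · support · rank 9 · open · by planner
sources: CohnKleinbergSzegedyUmans2005, lean:Summit.MatrixMultiplication.MatrixMultiplication.Theorems.HomocyclicSTPPDesigns.ClusteredCharts.homocyclicSTPPDesigns_of_clusteredTwoFamilies
[support] glue, provable now in one line: ClusteredTwoFamilies → HomocyclicSTPPDesigns from the
landed reduction
`Summit.MatrixMultiplication.MatrixMultiplication.Theorems.HomocyclicSTPPDesigns.ClusteredCharts.homocyclicSTPPDesigns_of_clusteredTwoFamilies`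
(p155276; proof `fun h => homocyclicSTPPDesigns_of_clusteredTwoFamilies h`, checked in the planner's
Sketch.lean). Makes the leaf load-bearing for `closes` (X′ derived from the leaf). [difficulty:
provable-now] -/
@[route_item "route-MatrixMultiplication-EisensteinValCertificates"]
def LeafGivesDesigns : Prop :=
  ClusteredTwoFamilies → HomocyclicSTPPDesigns

/-- item stmt-MatrixMultiplication-7791 · support · rank 9 · open · by planner
sources: Pratt2024
[support] calibration (card item T1; Pratt Prop 3.1 / 3.4 sharpened, any abelian group): an
equilateral-trapezoid-free triple has (#solutions)² ≤ |A||B||C| — the degree-4 Cauchy–Schwarz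
certificate (the d_a² pairs (b,c) of neighbours of a are disjoint across a ∈ A by the third system).
Gives Val(G) ≤ |G|^(3/2). [difficulty: provable-now] -/
@[route_item "route-MatrixMultiplication-EisensteinValCertificates"]
def TrapezoidCountBound : Prop :=
  ∀ (G : Type) [AddCommGroup G] [DecidableEq G] (A B C : Finset G), ((∀ a' ∈ A, ∀ b' ∈ B, ((A ×ˢ B ×ˢ C).filter (fun t : G × G × G => a' + t.2.1 + t.2.2 = 0 ∧ t.1 + b' + t.2.2 = 0)).card ≤ 1) ∧ (∀ a' ∈ A, ∀ c' ∈ C, ((A ×ˢ B ×ˢ C).filter (fun t : G × G × G => a' + t.2.1 + t.2.2 = 0 ∧ t.1 + t.2.1 + c' = 0)).card ≤ 1) ∧ (∀ b' ∈ B, ∀ c' ∈ C, ((A ×ˢ B ×ˢ C).filter (fun t : G × G × G => t.1 + b' + t.2.2 = 0 ∧ t.1 + t.2.1 + c' = 0)).card ≤ 1)) → ((A ×ˢ B ×ˢ C).filter (fun t : G × G × G => t.1 + t.2.1 + t.2.2 = 0)).card ^ 2 ≤ A.card * B.card * C.card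

/-- item stmt-MatrixMultiplication-7792 · support · rank 9 · open · by planner
sources: Pratt2024, BlasiakChurchCohnGrochowNaslundSawinUmans2017, lean:Literature.Computability.AlgebraicComplexity.IsSTPP.packing
[support] Pratt Prop 3.3 (with Prop 2.6): an STPP family (A_i,B_i,C_i) in an abelian group H yields
the triple (⋃_i (A_i − B_i), ⋃_i (B_i − C_i), ⋃_i (C_i − A_i)), which is equilateral-trapezoid-free
and has ≥ Σ_i |A_i||B_i||C_i| solutions ((i,s,t,u) ↦ (s−t, t−u, u−s) is injective by the STPP). Used
by ValTransfer and by the deferred two-families transfer. [difficulty: provable-now] -/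
@[route_item "route-MatrixMultiplication-EisensteinValCertificates"]
def STPPGivesVal : Prop :=
  ∀ (H : Type) [AddCommGroup H] [DecidableEq H] (N : ℕ) (A B C : Fin N → Finset H), Literature.Computability.AlgebraicComplexity.IsSTPP A B C → ∃ A' B' C' : Finset H, ((∀ a' ∈ A', ∀ b' ∈ B', ((A' ×ˢ B' ×ˢ C').filter (fun t : H × H × H => a' + t.2.1 + t.2.2 = 0 ∧ t.1 + b' + t.2.2 = 0)).card ≤ 1) ∧ (∀ a' ∈ A', ∀ c' ∈ C', ((A' ×ˢ B' ×ˢ C').filter (fun t : H × H × H => a' + t.2.1 + t.2.2 = 0 ∧ t.1 + t.2.1 + c' = 0)).card ≤ 1) ∧ (∀ b' ∈ B', ∀ c' ∈ C', ((A' ×ˢ B' ×ˢ C').filter (fun t : H × H × H => t.1 + b' + t.2.2 = 0 ∧ t.1 + t.2.1 + c' = 0)).card ≤ 1)) ∧ ∑ i, (A i).card * (B i).card * (C i).card ≤ ((A' ×ˢ B' ×ˢ C').filter (fun t : H × H × H => t.1 + t.2.1 + t.2.2 = 0)).card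

/-- item stmt-MatrixMultiplication-7795 · assembly · rank 1 · open · by planner
sources: CohnKleinbergSzegedyUmans2005, Pratt2024, lean:Literature.Computability.AlgebraicComplexity.CohnKleinbergSzegedyUmans2005_5_5_abelian_holds, lean:Literature.Computability.AlgebraicComplexity.omega_two_le
[assembly] ¬NoHomocyclicSTPP → ω(ℂ) = 2 (the summit), via CKSU Thm 5.5 (tree theorem) and ω ≥ 2. -/
@[route_item "route-MatrixMultiplication-EisensteinValCertificates"]
def Assembly : Prop :=
  ¬ NoHomocyclicSTPP → MatrixMultiplication

-- records of items no longer active in this route (dropped / restated):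
-- earlier PrimeValConjecture (stmt-MatrixMultiplication-7789, dropped 2026-08-17T13:07:07Z): refuted by Summit.MatrixMultiplication.MatrixMultiplication.Theorems.EisensteinValCertificatesPrimeValConjecture_refuted @ 0efa074c7b39 — ∀ ε : ℝ, 0 < ε → ∃ K : ℝ, ∀ p : ℕ, p.Prime → ∀ A B C : Finset (ZMod p), ((∀ a' ∈ A, ∀ b' ∈ B, ((A ×ˢ B ×ˢ C).filter (fun t : ZMod p × ZMod p × ZMod p => a' + t.2.1 + t.2.2

/-! D-0027 §2.1 — DECIDING THEOREM (planner-authored via `route open/edit --closes-file`; by planner-rbadge-MatrixMultiplication-Eisenstein-625de679-g2-0 2026-08-15T16:22:39Z):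
its hypotheses are this route's items and its conclusion the sub-problem Statement (glue_lint), and it elaborates with this file. -/

/-- DECIDING THEOREM (D-0027 §2.1) — the kill link of the dichotomy, pure bookkeeping over two tree
theorems: an STPP family in some (ℤ/q)^ℓ beating exponent (2+ε)/3 for EVERY ε > 0 (the target
`HomocyclicSTPPDesigns`, = ¬NoHomocyclicSTPP by `NoHomocyclicIffNotDesigns`) gives ω(ℂ) = 2:
if ω > 2 take ε := ω − 2, get q, ℓ and an STPP family in H := (Fin ℓ → ZMod q) with
Σ_i (|A_i||B_i||C_i|)^(ω/3) > q^ℓ = |H| (`Fintype.card_fun`, `ZMod.card`), contradicting CKSU 2005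
Thm 5.5, abelian case (`CohnKleinbergSzegedyUmans2005_5_5_abelian_holds`, proved in tree); hence
ω ≤ 2, and `omega_two_le ℂ` with `MatrixMultiplication_iff` closes. -/
@[closes "route-MatrixMultiplication-EisensteinValCertificates"] theorem closes (h : HomocyclicSTPPDesigns) : _root_.MatrixMultiplication := by
  rw [MatrixMultiplication_iff]
  refine le_antisymm ?_ (Literature.Computability.AlgebraicComplexity.omega_two_le ℂ)
  rcases le_or_gt (Literature.Computability.AlgebraicComplexity.omega ℂ) 2 with hle | hω
  · exact hle
  exfalso
  obtain ⟨q, ℓ, hq, N, A, B, C, hS, hlt⟩ :=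
    h (Literature.Computability.AlgebraicComplexity.omega ℂ - 2) (sub_pos.2 hω)
  haveI : NeZero q := ⟨hq.ne_zero⟩
  have h55 :=
    Literature.Computability.AlgebraicComplexity.CohnKleinbergSzegedyUmans2005_5_5_abelian_holds
      (Fin ℓ → ZMod q) N A B C hS
  have hcard : (Fintype.card (Fin ℓ → ZMod q) : ℝ) = (q : ℝ) ^ ℓ := by
    rw [Fintype.card_fun, ZMod.card, Fintype.card_fin]; push_cast; rfl
  have hexp : (2 + (Literature.Computability.AlgebraicComplexity.omega ℂ - 2)) / 3 =
      Literature.Computability.AlgebraicComplexity.omega ℂ / 3 := by ring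
  rw [hexp] at hlt
  rw [hcard] at h55
  exact absurd h55 (not_le.2 hlt)

end Summit.MatrixMultiplication.MatrixMultiplication.Theses.EisensteinValCertificates
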